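import Literature.Probability.RandomPlanarGeometry.PolygonWinding
import Literature.Probability.RandomPlanarGeometry.JordanIndex
import Literature.Topology.PlaneTopology.WindingNumberCrossing
import HarnessLib

/-!
# The inside of a positively oriented simple closed polygon lies to the left of every edge

Topic: Probability / RandomPlanarGeometry (companion to `PolygonalDomains.lean`,
`PolygonWinding.lean`, `JordanIndex.lean`). For a simple closed polygon `polygonLoop l`
(`AffineInterp.lean`) with inside `polygonDomain l h`, the edge number `k` runs from `l[k]` to
`l[(k + 1) % N]` (`N = l.length`) during `[k/N, (k+1)/N]`, with direction
`v = l[(k + 1) % N] - l[k] ≠ 0`; its left normal is `I • v`. For an interior point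
`q = polygonLoop l ((k + θ)/N)`, `θ ∈ (0, 1)`, of the edge:

* `segSide_normal_apply` — the side functional (`segSide`, `ArgumentIncrement.lean`) of the
  normal segment `[q + s I v, q - s I v]` at the point `q + a v` of the edge line is
  `-2 a s ‖v‖²`: the edge runs from the positive to the negative side of the normal segment;
* `wind_sub_wind_polygonLoop_normal` — **the jump of the winding number across an edge**: for
  all small `s > 0` the two points `q ± s I v` are off the polygon and
  `wind (polygonLoop l - (q + s I v)) - wind (polygonLoop l - (q - s I v)) = 1` — the crossing
  lemma `wind_sub_wind_of_straight_cross` (`Topology/PlaneTopology/WindingNumberCrossing.lean`)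
  applied to the straight piece `[k/N, (k+1)/N]` of the loop; the rest of the polygon is a
  compact set missing `q` (injectivity of the loop on a period), hence missing the short normal
  segment;
* `index_polygonDomain_eq_zero_or_mem` — off the polygon, a point is inside or has index `0`;
* `eventually_mem_polygonDomain_add_normal` — **inside on the left**: if the polygon is
  positively oriented (`(polygonDomain l h).index z = 1` on the inside, cf. `JordanIndex.lean`),
  then `q + s I v ∈ polygonDomain l h` for all small `s > 0` (the two winding numbers lie in
  `{0, 1}` and differ by `1`); `eventually_mem_polygonDomain_sub_normal` is the mirror statement
  for negative orientation (`index = -1`: inside on the right).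

All statements are folklore (Ahlfors, *Complex Analysis*, 3rd ed. (1979), §4.2.1, Lemma 2: the
winding number is constant off the curve and jumps by `±1` across an arc). Everything is proved.

## Mathlib / tree
Mathlib: `Metric.isOpen_iff`, `Convex.segment_subset`, `segment_eq_image_lineMap`,
`AffineMap.lineMap_apply_module'`. Tree: `wind_sub_wind_of_straight_cross`, `segSide_eq`,
`eventually_mul_lt_nhdsGT` (`WindingNumberCrossing.lean`), `segSide`,
`not_mem_segment_of_cross` (`ArgumentIncrement.lean`), `polygonLoop_apply_div`,
`polygonLoop_vertex`, `polygonLoop_fract`, `injOn_polygonLoop`, `frontier_polygonDomain_eq_range`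
(`AffineInterp.lean`, `PolygonalDomains.lean`), `JordanDomain.index_eq_zero_of_mem_exterior`
(`JordanIndex.lean`), `JordanDomain.mem_carrier_of_wind_ne_zero` (`PolygonWinding.lean`).
-/

noncomputable section

open Set Filter Topology Complex
open Literature.Topology.PlaneTopology

namespace Literature.Probability.RandomPlanarGeometry

variable {l : List ℂ}

/-- **The edge crosses its normal segment from the positive to the negative side**: the side
functional of the segment `[q + s I v, q - s I v]` at the point `q + a v` equals
`-2 a s ‖v‖²`. [folklore] -/
theorem segSide_normal_apply (q v : ℂ) (s a : ℝ) :
    segSide (q + s * (I * v)) (q - s * (I * v)) (q + a * v) = -(2 * a * s * Complex.normSq v) := by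
  rw [segSide_eq]
  simp only [Complex.sub_re, Complex.sub_im, Complex.add_re, Complex.add_im, Complex.mul_re,
    Complex.mul_im, Complex.ofReal_re, Complex.ofReal_im, Complex.I_re, Complex.I_im,
    Complex.normSq_apply]
  ring

/-- **The jump of the winding number of a simple closed polygon across an edge.** Let
`q = polygonLoop l ((k + θ)/N)` (`θ ∈ (0, 1)`) be an interior point of edge `k`, of direction
`v = l[(k + 1) % N] - l[k]`. For all small `s > 0` the points `q ± s I v` are off the polygon and
`wind (polygonLoop l - (q + s I v)) - wind (polygonLoop l - (q - s I v)) = 1`: the winding number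
about the point on the left of the edge exceeds the one about the point on the right by one.
[folklore] -/
theorem wind_sub_wind_polygonLoop_normal (h : IsSimpleClosedPolygon l) {k : ℕ} (hk : k < l.length)
    {θ : ℝ} (hθ : θ ∈ Ioo (0 : ℝ) 1) {q v : ℂ}
    (hq : q = polygonLoop l ((k + θ) / l.length))
    (hv : v = l[(k + 1) % l.length]'(Nat.mod_lt _ h.pos) - l[k]) :
    ∀ᶠ s : ℝ in 𝓝[>] 0, q + s * (I * v) ∉ range (polygonLoop l) ∧
      q - s * (I * v) ∉ range (polygonLoop l) ∧
      wind (fun t ↦ polygonLoop l t - (q + s * (I * v))) -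
        wind (fun t ↦ polygonLoop l t - (q - s * (I * v))) = 1 := by
  have hN : (0 : ℝ) < l.length := by exact_mod_cast h.pos
  have hv0 : v ≠ 0 := hv ▸ sub_ne_zero.2 (h.ne k hk).symm
  -- the parameter interval `[u, u']` of edge `k`
  obtain ⟨u, hu⟩ : ∃ u : ℝ, u = k / l.length := ⟨_, rfl⟩
  obtain ⟨u', hu'⟩ : ∃ u' : ℝ, u' = (k + 1) / l.length := ⟨_, rfl⟩
  have hu0 : 0 ≤ u := hu ▸ div_nonneg k.cast_nonneg hN.le
  have huu' : u < u' := by rw [hu, hu']; exact div_lt_div_of_pos_right (lt_add_one _) hN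
  have hu'1 : u' ≤ 1 := by rw [hu']; exact div_le_one_of_le₀ (by exact_mod_cast hk) hN.le
  have hd : u' - u = 1 / l.length := by rw [hu, hu', div_sub_div_same, add_sub_cancel_left]
  -- the time of `q` lies strictly inside it
  have htq : u < (k + θ) / l.length ∧ (k + θ) / l.length < u' := by
    rw [hu, hu']
    exact ⟨div_lt_div_of_pos_right (by linarith [hθ.1]) hN,
      div_lt_div_of_pos_right (by linarith [hθ.2]) hN⟩
  have htq01 : ((k : ℝ) + θ) / l.length ∈ Ico (0 : ℝ) 1 :=
    ⟨hu0.trans htq.1.le, htq.2.trans_le hu'1⟩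
  -- values at the ends of the edge, and the ends in terms of `q`
  have hLu : polygonLoop l u = l[k] := hu ▸ polygonLoop_vertex hk
  have hLu' : polygonLoop l u' = l[(k + 1) % l.length]'(Nat.mod_lt _ h.pos) := by
    have e := polygonLoop_apply_div hk (θ := 1) ⟨zero_le_one, le_rfl⟩
    rwa [AffineMap.lineMap_apply_one, ← hu'] at e
  have hqθ : q = AffineMap.lineMap l[k] (l[(k + 1) % l.length]'(Nat.mod_lt _ h.pos)) θ :=
    hq.trans (polygonLoop_apply_div hk ⟨hθ.1.le, hθ.2.le⟩)
  have hqk : l[k] = q + ((-θ : ℝ) : ℂ) * v := by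
    rw [hqθ, AffineMap.lineMap_apply_module', ← hv, Complex.real_smul]
    push_cast
    ring
  have hqk' : l[(k + 1) % l.length]'(Nat.mod_lt _ h.pos) = q + ((1 - θ : ℝ) : ℂ) * v := by
    have e : l[(k + 1) % l.length]'(Nat.mod_lt _ h.pos) = v + l[k] := by rw [hv, sub_add_cancel]
    rw [e, hqk]
    push_cast
    ring
  -- the loop is straight on `[u, u']`
  have hmid : ∀ t ∈ Icc u u', polygonLoop l t =
      AffineMap.lineMap (polygonLoop l u) (polygonLoop l u') ((t - u) / (u' - u)) := by
    intro t ht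
    have h01 : (t - u) / (u' - u) ∈ Icc (0 : ℝ) 1 :=
      ⟨div_nonneg (sub_nonneg.2 ht.1) (sub_pos.2 huu').le,
        div_le_one_of_le₀ (sub_le_sub_right ht.2 _) (sub_pos.2 huu').le⟩
    have e : t = (k + (t - u) / (u' - u)) / l.length := by
      rw [hd, hu]
      field_simp
      ring
    rw [hLu, hLu']
    conv_lhs => rw [e]
    exact polygonLoop_apply_div hk h01
  -- the rest of the polygon is a compact set missing `q`
  set K : Set ℂ := polygonLoop l '' (Icc 0 u ∪ Icc u' 1) with hK
  have hKc : IsCompact K := (isCompact_Icc.union isCompact_Icc).image (continuous_polygonLoop l)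
  have hinj := injOn_polygonLoop h
  have hqK : q ∉ K := by
    rintro ⟨t, ht, htq'⟩
    have ht01 : t ∈ Icc (0 : ℝ) 1 := by
      rcases ht with ht | ht
      · exact ⟨ht.1, ht.2.trans (huu'.le.trans hu'1)⟩
      · exact ⟨hu0.trans (huu'.le.trans ht.1), ht.2⟩
    rcases ht01.2.lt_or_eq with h1 | h1
    · have e := hinj ⟨ht01.1, h1⟩ htq01 (htq'.trans hq)
      rcases ht with ht | ht
      · linarith [ht.2, htq.1]
      · linarith [ht.1, htq.2]
    · rw [h1] at htq'
      have h0 : polygonLoop l 0 = q := by rw [← htq', ← periodic_polygonLoop l 0, zero_add]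
      have e := hinj ⟨le_rfl, zero_lt_one⟩ htq01 (h0.trans hq)
      linarith [htq.1]
  obtain ⟨d, hd0, hdK⟩ := Metric.isOpen_iff.1 hKc.isClosed.isOpen_compl q hqK
  -- small `s`: the normal segment lies in the ball `B(q, d)`, which misses `K`
  filter_upwards [self_mem_nhdsWithin, eventually_mul_lt_nhdsGT (M := ‖v‖) hd0] with s hs hsd
  have hs0 : (0 : ℝ) < s := hs
  obtain ⟨ℓ, hℓ⟩ : ∃ ℓ : ℂ, ℓ = q + s * (I * v) := ⟨_, rfl⟩
  obtain ⟨r, hr⟩ : ∃ r : ℂ, r = q - s * (I * v) := ⟨_, rfl⟩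
  rw [← hℓ, ← hr]
  have hnorm : ‖(s : ℂ) * (I * v)‖ = ‖v‖ * s := by
    rw [norm_mul, norm_mul, Complex.norm_real, Complex.norm_I, one_mul,
      Real.norm_of_nonneg hs0.le, mul_comm]
  have hℓb : ℓ ∈ Metric.ball q d := by
    rw [Metric.mem_ball, dist_eq_norm, hℓ, add_sub_cancel_left, hnorm]
    exact hsd
  have hrb : r ∈ Metric.ball q d := by
    rw [Metric.mem_ball, dist_eq_norm, hr, sub_sub_cancel_left, norm_neg, hnorm]
    exact hsd
  have hsegb : segment ℝ ℓ r ⊆ Metric.ball q d := (convex_ball q d).segment_subset hℓb hrb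
  have hout : ∀ t ∈ Icc 0 u ∪ Icc u' 1, polygonLoop l t ∉ segment ℝ ℓ r :=
    fun t ht hmem ↦ hdK (hsegb hmem) ⟨t, ht, rfl⟩
  -- the edge runs from the positive to the negative side of the normal segment, through `q`
  have hnv : 0 < Complex.normSq v := Complex.normSq_pos.2 hv0
  have hA : 0 < segSide ℓ r (polygonLoop l u) := by
    rw [hLu, hqk, hℓ, hr, segSide_normal_apply]
    have e : -(2 * -θ * s * Complex.normSq v) = 2 * θ * s * Complex.normSq v := by ring
    rw [e]
    exact mul_pos (mul_pos (mul_pos two_pos hθ.1) hs0) hnv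
  have hB : segSide ℓ r (polygonLoop l u') < 0 := by
    rw [hLu', hqk', hℓ, hr, segSide_normal_apply]
    have e : 0 < 2 * (1 - θ) * s * Complex.normSq v :=
      mul_pos (mul_pos (mul_pos two_pos (by linarith [hθ.2])) hs0) hnv
    linarith
  have hx : ∃ p ∈ segment ℝ (polygonLoop l u) (polygonLoop l u'),
      p ∈ openSegment ℝ ℓ r := by
    refine ⟨q, ?_, ?_⟩
    · rw [hLu, hLu', segment_eq_image_lineMap]
      exact ⟨θ, ⟨hθ.1.le, hθ.2.le⟩, hqθ.symm⟩
    · refine ⟨1 / 2, 1 / 2, by norm_num, by norm_num, by norm_num, ?_⟩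
      rw [hℓ, hr, Complex.real_smul, Complex.real_smul]
      push_cast
      ring
  -- the crossing lemma
  have hLc : ContinuousOn (polygonLoop l) (Icc 0 1) := (continuous_polygonLoop l).continuousOn
  have h01 : polygonLoop l 0 = polygonLoop l 1 := by
    simpa using (periodic_polygonLoop l 0).symm
  have key := wind_sub_wind_of_straight_cross hu0 huu' hu'1 hLc h01 hmid hout hA hB hx
  simp only [zero_add, sub_zero, mul_one] at key
  -- both points are off the polygon: off edge `k` and in the ball missing the other edges
  obtain ⟨hℓs, hrs⟩ := not_mem_segment_of_cross hA hB hx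
  have hrange :
      range (polygonLoop l) ⊆ segment ℝ (polygonLoop l u) (polygonLoop l u') ∪ K := by
    rintro _ ⟨t, rfl⟩
    rw [← polygonLoop_fract l t]
    by_cases ht : Int.fract t ∈ Icc u u'
    · left
      rw [hmid _ ht, segment_eq_image_lineMap]
      exact ⟨_, ⟨div_nonneg (sub_nonneg.2 ht.1) (sub_pos.2 huu').le,
        div_le_one_of_le₀ (sub_le_sub_right ht.2 _) (sub_pos.2 huu').le⟩, rfl⟩
    · right
      refine ⟨Int.fract t, ?_, rfl⟩
      rw [mem_Icc, not_and_or, not_le, not_le] at ht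
      rcases ht with ht | ht
      · exact Or.inl ⟨Int.fract_nonneg t, ht.le⟩
      · exact Or.inr ⟨ht.le, (Int.fract_lt_one t).le⟩
  refine ⟨fun hmem ↦ ?_, fun hmem ↦ ?_, key⟩
  · rcases hrange hmem with h1 | h1
    · exact hℓs h1
    · exact hdK hℓb h1
  · rcases hrange hmem with h1 | h1
    · exact hrs h1
    · exact hdK hrb h1

/-- The index of the polygonal domain about `w` is the winding number of `polygonLoop l - w`.
[folklore] -/
theorem index_polygonDomain_eq_wind (h : IsSimpleClosedPolygon l) (w : ℂ) :
    (polygonDomain l h).index w = wind (fun t ↦ polygonLoop l t - w) := rfl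

/-- Off the polygon, a point is inside the polygonal domain or has index `0` (it is then in the
exterior). [folklore] -/
theorem index_polygonDomain_eq_zero_or_mem (h : IsSimpleClosedPolygon l) {w : ℂ}
    (hw : w ∉ range (polygonLoop l)) :
    (polygonDomain l h).index w = 0 ∨ w ∈ (polygonDomain l h).carrier := by
  by_cases hwP : w ∈ (polygonDomain l h).carrier
  · exact Or.inr hwP
  · refine Or.inl ((polygonDomain l h).index_eq_zero_of_mem_exterior fun hw' ↦ ?_)
    rw [(polygonDomain l h).closure_eq, polygonDomain_boundary] at hw'
    exact hw'.elim hwP hw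

/-- **The inside of a positively oriented simple closed polygon is on the left of every edge.**
If `(polygonDomain l h).index z = 1` for the points `z` of the domain, then for every edge `k`,
every `θ ∈ (0, 1)` and all small `s > 0`, the point
`polygonLoop l ((k + θ)/N) + s · I (l[(k + 1) % N] - l[k])` lies in the domain. [folklore] -/
theorem eventually_mem_polygonDomain_add_normal (h : IsSimpleClosedPolygon l)
    (hidx : ∀ z ∈ (polygonDomain l h).carrier, (polygonDomain l h).index z = 1)
    {k : ℕ} (hk : k < l.length) {θ : ℝ} (hθ : θ ∈ Ioo (0 : ℝ) 1) :
    ∀ᶠ s : ℝ in 𝓝[>] 0, polygonLoop l ((k + θ) / l.length) +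
      (s : ℂ) * (I * (l[(k + 1) % l.length]'(Nat.mod_lt _ h.pos) - l[k])) ∈
        (polygonDomain l h).carrier := by
  filter_upwards [wind_sub_wind_polygonLoop_normal h hk hθ rfl rfl] with s hs
  obtain ⟨hℓ, hr, hw⟩ := hs
  have hval : ∀ w, w ∉ range (polygonLoop l) →
      wind (fun t ↦ polygonLoop l t - w) = 0 ∨ wind (fun t ↦ polygonLoop l t - w) = 1 := by
    intro w hw'
    rcases index_polygonDomain_eq_zero_or_mem h hw' with h0 | h1
    · exact Or.inl ((index_polygonDomain_eq_wind h w) ▸ h0)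
    · exact Or.inr ((index_polygonDomain_eq_wind h w) ▸ hidx w h1)
  refine (polygonDomain l h).mem_carrier_of_wind_ne_zero
    (by rwa [frontier_polygonDomain_eq_range]) ?_
  have h1 := hval _ hℓ
  have h2 := hval _ hr
  simp only [polygonDomain_boundary]
  omega

/-- **The inside of a negatively oriented simple closed polygon is on the right of every edge**:
the mirror statement of `eventually_mem_polygonDomain_add_normal` for `index = -1`. [folklore] -/
theorem eventually_mem_polygonDomain_sub_normal (h : IsSimpleClosedPolygon l)
    (hidx : ∀ z ∈ (polygonDomain l h).carrier, (polygonDomain l h).index z = -1)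
    {k : ℕ} (hk : k < l.length) {θ : ℝ} (hθ : θ ∈ Ioo (0 : ℝ) 1) :
    ∀ᶠ s : ℝ in 𝓝[>] 0, polygonLoop l ((k + θ) / l.length) -
      (s : ℂ) * (I * (l[(k + 1) % l.length]'(Nat.mod_lt _ h.pos) - l[k])) ∈
        (polygonDomain l h).carrier := by
  filter_upwards [wind_sub_wind_polygonLoop_normal h hk hθ rfl rfl] with s hs
  obtain ⟨hℓ, hr, hw⟩ := hs
  have hval : ∀ w, w ∉ range (polygonLoop l) →
      wind (fun t ↦ polygonLoop l t - w) = 0 ∨ wind (fun t ↦ polygonLoop l t - w) = -1 := by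
    intro w hw'
    rcases index_polygonDomain_eq_zero_or_mem h hw' with h0 | h1
    · exact Or.inl ((index_polygonDomain_eq_wind h w) ▸ h0)
    · exact Or.inr ((index_polygonDomain_eq_wind h w) ▸ hidx w h1)
  refine (polygonDomain l h).mem_carrier_of_wind_ne_zero
    (by rwa [frontier_polygonDomain_eq_range]) ?_
  have h1 := hval _ hℓ
  have h2 := hval _ hr
  simp only [polygonDomain_boundary]
  omega

end Literature.Probability.RandomPlanarGeometry
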